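import Summits.AtomisticToContinuum.Crystallization.Theorems.ChargedEnergyGapEdgeSpaceDeficitB
import HarnessLib

/-!
# NODE 74 «EdgeSpaceDeficit» (lens-3 g74) — part 3 of 3 (sequel of `…ChargedEnergyGapEdgeSpaceDeficitB`)

Split for the 400-line cap by the landing lane (hand-2 g36); the module docstring of part 1 (`…ChargedEnergyGapEdgeSpaceDeficitA`) describes the whole node.  Same namespace; all FQNs unchanged.
0 sorry; standard axioms.
-/

noncomputable section
open scoped Classical
open Literature.MathematicalPhysics.StatisticalMechanics Literature.Geometry.DiscreteGeometry
open Summit.AtomisticToContinuum.Crystallization.Theses.PricedLinkCensus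
open Summit.AtomisticToContinuum.Crystallization.Theorems.ChargedEnergyGapNegative

namespace Summit.AtomisticToContinuum.Crystallization.Theorems.ChargedEnergyGapChartDial

/-! ## §7 The split beneath (Λ): WEAK DUALITY (Λ₂, PROVED) and the CERTIFICATE LEDGER (Λ₁)

The e-space form `M(W)` has at most THREE negative directions (the diagonal modes), so the box programme behind `octDeficit` has a natural
Lagrangian dual with three multipliers `ν_a ≥ 0` on the diagonal elongations (`|D_a| ≤ τ·2ρ` for admissible `u`):
  if `⅛·octEW(W) + (c/4)·octDW(W) + Σ_a ν_a D_a² ≥ 0` on every displacement, then `octDeficit ≤ (τ·2ρ)²·Σ_a ν_a`   (weak duality, `octDeficit_le_of_mem_octCertSet`).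
Numerically the dual is EXACT on every fold pattern (`num/sdual.py`: ratio 1.000 on w-folds δ′ 22–35 and χ-folds of both signs at a = 0.970 and 0.9713),
so replacing the deficit by the best certificate value loses nothing where the ledger is tight.  (Λ₁) `OctCertLedgerQ` is (Λ) with `octDeficit` replaced
by `octCertVal := inf` of certificate values — a statement about the WEIGHT FIELD ALONE (six weights per framed octahedron, an explicit quadratic
non-negativity per certificate, one global budget): no displacement, no supremum over fields.  Glue `octDefLedgerQ_of_certLedger` PROVED. -/

section Dual

variable {P : PeriodicConfiguration 3} {c : E3} {f : Fin 3 → E3} {ρ : ℝ} {y z : E3}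

/-- A DUAL CERTIFICATE for the vertex weights `Wv` on a frame of half-diagonal `ρ`: non-negative diagonal multipliers `ν` making the e-space form, shifted
by `Σ_a ν_a D_a²`, non-negative on EVERY displacement (a positive-semidefiniteness statement about an explicit 18-variable quadratic). -/
def OctCert (c : E3) (f : Fin 3 → E3) (ρ : ℝ) (Wv : Fin 3 × Bool → ℝ) (ν : Fin 3 → ℝ) : Prop :=
  (∀ a, 0 ≤ ν a) ∧ ∀ u : E3 → E3,
    0 ≤ (1 / 8) * octEW Wv (frameAtom c f ρ u) + (ljD2 (2 * ρ) - ljD1 (2 * ρ) / (2 * ρ)) / 4 * octDW Wv (frameAtom c f ρ u) +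
      octDW (fun p => ν p.1 / 2) (frameAtom c f ρ u)

/-- The CERTIFICATE VALUES of the octahedron of `(y, z)` for the weight `W` and Lipschitz constant `τ`: `(τ·2ρ)²·Σ_a ν_a` over all frames of the pair
(`InOct ↔ vertices`, `ρ√2 ≤ r₁ < 2ρ`) and all dual certificates `ν` of the induced vertex weights. -/
def octCertSet (r₁ τ : ℝ) (W : E3 → ℝ) (P : PeriodicConfiguration 3) (y z : E3) : Set ℝ :=
  {t | ∃ (c : E3) (f : Fin 3 → E3) (ρ : ℝ) (ν : Fin 3 → ℝ), Orthonormal ℝ f ∧ 0 < ρ ∧ ρ * Real.sqrt 2 ≤ r₁ ∧ r₁ < 2 * ρ ∧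
    (∀ x : E3, InOct P r₁ y z x ↔ ∃ i b, x = octVertex c f ρ i b) ∧ OctCert c f ρ (fun p => W (octVertex c f ρ p.1 p.2)) ν ∧
    t = (τ * (2 * ρ)) ^ 2 * (ν 0 + ν 1 + ν 2)}

/-- ★ The BEST CERTIFICATE VALUE `octCertVal := inf octCertSet` (the SDP dual value of the box programme; `0` by convention if no frame exists). -/
def octCertVal (r₁ τ : ℝ) (W : E3 → ℝ) (P : PeriodicConfiguration 3) (y z : E3) : ℝ :=
  sInf (octCertSet r₁ τ W P y z)

/-- `octCertSet_nonneg` (docstring added by the landing lane; see the module docstring). [formal bookkeeping] -/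
theorem octCertSet_nonneg {r₁ τ : ℝ} {W : E3 → ℝ} {t : ℝ} (ht : t ∈ octCertSet r₁ τ W P y z) : 0 ≤ t := by
  obtain ⟨c, f, ρ, ν, -, -, -, -, -, ⟨hν, -⟩, rfl⟩ := ht
  have := hν 0; have := hν 1; have := hν 2
  positivity

/-- The diagonal atom difference of an admissible displacement is at most `τ·2ρ` in absolute value. -/
theorem frameAtom_diag_sq_le (hf : Orthonormal ℝ f) (hρ : 0 < ρ) {r₁ τ : ℝ} {u : E3 → E3}
    (hO : ∀ x : E3, InOct P r₁ y z x ↔ ∃ i b, x = octVertex c f ρ i b) (hu : OctLip P r₁ τ y z u) (a : Fin 3) :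
    (frameAtom c f ρ u a (a, true) - frameAtom c f ρ u a (a, false)) ^ 2 ≤ (τ * (2 * ρ)) ^ 2 := by
  have hin : ∀ i b, InOct P r₁ y z (octVertex c f ρ i b) := fun i b => (hO _).2 ⟨i, b, rfl⟩
  have h1 : frameAtom c f ρ u a (a, true) - frameAtom c f ρ u a (a, false) =
      inner ℝ (f a) (u (octVertex c f ρ a true) - u (octVertex c f ρ a false)) := by
    unfold frameAtom; rw [inner_sub_right]
  have h2 : |inner ℝ (f a) (u (octVertex c f ρ a true) - u (octVertex c f ρ a false))| ≤ τ * (2 * ρ) := by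
    refine (abs_real_inner_le_norm _ _).trans ?_
    rw [hf.1 a, one_mul]
    refine (hu _ _ (hin a false) (hin a true)).trans ?_
    rw [dist_octVertex_diag hf hρ.le a (show false ≠ true by decide)]
  rw [h1]
  have h3 : 0 ≤ τ * (2 * ρ) := (abs_nonneg _).trans h2
  exact sq_le_sq' (by linarith [neg_abs_le (inner ℝ (f a) (u (octVertex c f ρ a true) - u (octVertex c f ρ a false)))])
    ((le_abs_self _).trans h2)

/-- ★★ **(Λ₂) WEAK DUALITY, PROVED**: every certificate value bounds the Lipschitz-box deficit. -/
theorem octDeficit_le_of_mem_octCertSet {r₁ τ : ℝ} (hτ : 0 ≤ τ) {W : E3 → ℝ} {t : ℝ} (ht : t ∈ octCertSet r₁ τ W P y z) :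
    octDeficit (1 / 2) r₁ τ W P y z ≤ t := by
  obtain ⟨c, f, ρ, ν, hf, hρ, hedge, hdiag, hO, ⟨hν, hcert⟩, rfl⟩ := ht
  unfold octDeficit
  refine csSup_le ⟨_, ⟨fun _ => 0, octLip_zero hτ y z, rfl⟩⟩ ?_
  rintro _ ⟨u, hu, rfl⟩
  show -octForm (1 / 2) r₁ W ∅ (fun p q => u q - u p) P y z ≤ _
  rw [octForm_frameW hf hρ W ∅ (fun p q => u q - u p) u hedge hdiag hO (fun _ _ => by simp) (fun _ _ _ _ => rfl)]
  have hc := hcert u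
  have hd := fun a => frameAtom_diag_sq_le hf hρ hO hu a
  have e0 := hd 0; have e1 := hd 1; have e2 := hd 2
  have hν0 := hν 0; have hν1 := hν 1; have hν2 := hν 2
  have hDW : octDW (fun p : Fin 3 × Bool => ν p.1 / 2) (frameAtom c f ρ u) ≤ (τ * (2 * ρ)) ^ 2 * (ν 0 + ν 1 + ν 2) := by
    unfold octDW
    simp only
    nlinarith [mul_le_mul_of_nonneg_left e0 hν0, mul_le_mul_of_nonneg_left e1 hν1, mul_le_mul_of_nonneg_left e2 hν2]
  linarith

/-- On a framed pair with NON-NEGATIVE weights a certificate always exists (`ν_a = |c|/4·(W_a⁺ + W_a⁻)`), so `octCertSet` is non-empty. -/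
theorem octCertSet_nonempty (hf : Orthonormal ℝ f) (hρ : 0 < ρ) {r₁ τ : ℝ} (hedge : ρ * Real.sqrt 2 ≤ r₁) (hdiag : r₁ < 2 * ρ)
    {W : E3 → ℝ} (hW0 : ∀ x, 0 ≤ W x) (hO : ∀ x : E3, InOct P r₁ y z x ↔ ∃ i b, x = octVertex c f ρ i b) :
    (octCertSet r₁ τ W P y z).Nonempty := by
  set cρ : ℝ := ljD2 (2 * ρ) - ljD1 (2 * ρ) / (2 * ρ) with hcρ
  set ν : Fin 3 → ℝ := fun a => |cρ| / 4 * (W (octVertex c f ρ a true) + W (octVertex c f ρ a false)) with hν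
  refine ⟨_, c, f, ρ, ν, hf, hρ, hedge, hdiag, hO, ⟨fun a => ?_, fun u => ?_⟩, rfl⟩
  · have := hW0 (octVertex c f ρ a true); have := hW0 (octVertex c f ρ a false); positivity
  · have hE : 0 ≤ octEW (fun p : Fin 3 × Bool => W (octVertex c f ρ p.1 p.2)) (frameAtom c f ρ u) := by
      unfold octEW
      have := fun i b => hW0 (octVertex c f ρ i b)
      have h00 := this 0 true; have h01 := this 0 false; have h10 := this 1 true; have h11 := this 1 false
      have h20 := this 2 true; have h21 := this 2 false
      positivity
    have hDterm : ∀ a : Fin 3, 0 ≤ cρ / 4 * ((W (octVertex c f ρ a true) + W (octVertex c f ρ a false)) *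
        (frameAtom c f ρ u a (a, true) - frameAtom c f ρ u a (a, false)) ^ 2) +
        (ν a / 2 + ν a / 2) * (frameAtom c f ρ u a (a, true) - frameAtom c f ρ u a (a, false)) ^ 2 := by
      intro a
      have hS : 0 ≤ W (octVertex c f ρ a true) + W (octVertex c f ρ a false) := by
        have := hW0 (octVertex c f ρ a true); have := hW0 (octVertex c f ρ a false); positivity
      have hsq : 0 ≤ (frameAtom c f ρ u a (a, true) - frameAtom c f ρ u a (a, false)) ^ 2 := sq_nonneg _
      have hνa : ν a / 2 + ν a / 2 = |cρ| / 4 * (W (octVertex c f ρ a true) + W (octVertex c f ρ a false)) := by rw [hν]; ring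
      rw [hνa]
      have : 0 ≤ (cρ + |cρ|) / 4 * ((W (octVertex c f ρ a true) + W (octVertex c f ρ a false)) *
          (frameAtom c f ρ u a (a, true) - frameAtom c f ρ u a (a, false)) ^ 2) := by
        have hcc : 0 ≤ cρ + |cρ| := by linarith [neg_abs_le cρ]
        positivity
      linarith
    have h0 := hDterm 0; have h1 := hDterm 1; have h2 := hDterm 2
    unfold octDW
    simp only
    nlinarith

/-- ★ Hence on a framed pair with non-negative weights the deficit is bounded by the best certificate value. -/
theorem octDeficit_le_octCertVal (hf : Orthonormal ℝ f) (hρ : 0 < ρ) {r₁ τ : ℝ} (hτ : 0 ≤ τ) (hedge : ρ * Real.sqrt 2 ≤ r₁)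
    (hdiag : r₁ < 2 * ρ) {W : E3 → ℝ} (hW0 : ∀ x, 0 ≤ W x) (hO : ∀ x : E3, InOct P r₁ y z x ↔ ∃ i b, x = octVertex c f ρ i b) :
    octDeficit (1 / 2) r₁ τ W P y z ≤ octCertVal r₁ τ W P y z :=
  le_csInf (octCertSet_nonempty hf hρ hedge hdiag hW0 hO) fun _ ht => octDeficit_le_of_mem_octCertSet hτ ht

/-- `octCertVal_nonneg` (docstring added by the landing lane; see the module docstring). [formal bookkeeping] -/
theorem octCertVal_nonneg {r₁ τ : ℝ} {W : E3 → ℝ} : 0 ≤ octCertVal r₁ τ W P y z := by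
  unfold octCertVal
  by_cases h : (octCertSet r₁ τ W P y z).Nonempty
  · exact le_csInf h fun _ ht => octCertSet_nonneg ht
  · rw [Set.not_nonempty_iff_eq_empty.1 h, Real.sInf_empty]

end Dual

section CertLedger

variable (ϱχ : ℝ) {m : ℕ} (D : Fin m → Set E3) (σ : Fin m → Bool)

/-- The **CERTIFICATE SHELL FUNCTIONAL**: `octDefShellL` with the deficit replaced by the best certificate value. -/
def octCertShellL (r₁ r₂ τ : ℝ) (P : PeriodicConfiguration 3) (X : Set E3) (ϱ : ℝ) (C : Set E3) : ℝ :=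
  ∑ y ∈ P.motif, ∑ᶠ z : E3,
    if (z ∈ P.points ∧ r₁ < dist y z ∧ dist y z ≤ r₂) ∧
        (OctClean P r₁ X y z ∧ ¬OctPlateau P r₁ (siteW ϱχ D σ X ϱ C) y z) then
      (1 / 6) * octCertVal r₁ τ (siteW ϱχ D σ X ϱ C) P y z
    else 0

/-- ★★ **(Λ₁) THE CERTIFICATE LEDGER** (`κ₂ = ½` built in): for every reference of class `cls` (separated, labelled, force-free, site-stress-free,
framed) and all invariant `C, X, Dᵢ`, one sixth of the best dual-certificate values of the shell octahedra is paid by the three currencies.  A statement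
about the WEIGHT FIELD `siteW` of invariant closed sets on one lattice and explicit 18-variable quadratics — no displacement field anywhere.
[UNDECIDED → TRUE-leaning · INSTRUMENTABLE (it IS the object of `num/`: the dual is exact on folds) · ATTACKABLE-L; door [SEMICONCAVE]] -/
def OctCertLedgerQ (cls : Set E3 → Prop) (s lam ℓ τ ϱ ϱχ r₁ r₂ : ℝ) (ρlo ρhi c_T cχ : ℝ) : Prop :=
  ∃ c_H : ℝ, 0 ≤ c_H ∧ ∀ (P : PeriodicConfiguration 3) (C X : Set E3) (m : ℕ) (D : Fin m → Set E3) (σ : Fin m → Bool),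
    IsSeparatedRef s P → IsLabelledRef lam ℓ P → cls P.points → IsForceFree P → IsSiteStressFree P →
    IsInvariantSet P C → IsInvariantSet P X → (∀ i, IsInvariantSet P (D i)) → IsFramedOct P r₁ r₂ ρlo ρhi →
      octCertShellL ϱχ D σ r₁ r₂ τ P X ϱ C ≤
        c_T * shellMassL ϱχ D σ P X ϱ C + cχ * transMassL ϱχ D σ P X ϱ C + c_H * (pricedNearCountL ϱχ D σ P X ϱ C : ℝ)

variable {ϱχ D σ}

/-- ★★ **GLUE beneath (Λ), PROVED**: (Λ₁) ⟹ (Λ) at `r₁ = 6/5`, `κ₂ = ½`, `ρ ∈ [0.679, 0.691]`, any `τ ≥ 0`, any class and separation: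
termwise weak duality (Λ₂) on each framed shell octahedron (`ρ√2 ≤ 0.978 < 6/5 < 1.358 ≤ 2ρ`). -/
theorem octDefLedgerQ_of_certLedger {cls : Set E3 → Prop} {s lam ℓ τ ϱ r₂ c_T cχ : ℝ} (hs : 0 < s) (hτ : 0 ≤ τ)
    (h : OctCertLedgerQ cls s lam ℓ τ ϱ ϱχ (6 / 5) r₂ (679 / 1000) (691 / 1000) c_T cχ) :
    OctDefLedgerQ cls s lam ℓ τ ϱ ϱχ (6 / 5) r₂ (1 / 2) (679 / 1000) (691 / 1000) c_T cχ := by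
  classical
  obtain ⟨c_H, hc, h⟩ := h
  refine ⟨c_H, hc, fun P C X m D σ h1 h2 hcl h3 h4 h6 h7 h11 hFr => ?_⟩
  refine le_trans ?_ (h P C X m D σ h1 h2 hcl h3 h4 h6 h7 h11 hFr)
  unfold octDefShellL octCertShellL
  refine Finset.sum_le_sum fun y hy => ?_
  have hyP : y ∈ P.points := P.mem_points_of_mem_motif hy
  have hF := h1.finite_inter_closedBall hs y r₂
  set T : Finset E3 := hF.toFinset with hT
  have hmemT : ∀ z, z ∈ P.points → dist y z ≤ r₂ → z ∈ T := fun z hz hd => by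
    rw [hT, Set.Finite.mem_toFinset]
    exact ⟨hz, Metric.mem_closedBall.2 (by rw [dist_comm]; exact hd)⟩
  rw [finsum_eq_sum_of_support_subset (s := T), finsum_eq_sum_of_support_subset (s := T)]
  · refine Finset.sum_le_sum fun z _ => ?_
    split_ifs with hsel
    · obtain ⟨c, f, ρ, hf, hρ1, hρ2, -, -, hO⟩ := hFr y hyP z hsel.1.1 hsel.1.2.1 hsel.1.2.2
      have hρ : 0 < ρ := by linarith
      have hs2 : Real.sqrt 2 ≤ 3 / 2 := by
        rw [show (3 / 2 : ℝ) = Real.sqrt ((3 / 2) ^ 2) by rw [Real.sqrt_sq (by norm_num)]]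
        exact Real.sqrt_le_sqrt (by norm_num)
      have hedge : ρ * Real.sqrt 2 ≤ 6 / 5 := by nlinarith [Real.sqrt_nonneg 2]
      have key := octDeficit_le_octCertVal (P := P) (y := y) (z := z) hf hρ hτ hedge (by linarith)
        (fun x => siteW_nonneg X ϱ C x) hO (W := siteW ϱχ D σ X ϱ C)
      linarith
    · exact le_rfl
  · intro z hz
    by_contra hzT
    exact (Function.mem_support.1 hz) (if_neg fun h' => hzT (hmemT z h'.1.1 h'.1.2.2))
  · intro z hz
    by_contra hzT
    exact (Function.mem_support.1 hz) (if_neg fun h' => hzT (hmemT z h'.1.1 h'.1.2.2))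

/-- ★★★ **THE q-DESIGNATE THROUGH THE CERTIFICATE LEDGER**: the cone of §6 with (Λ) replaced by (Λ₁) `OctCertLedgerQ` over the exact class — (Λ₂)
weak duality and the glue proved (§7), everything else verbatim. -/
theorem chargedEnergyGap_of_certLedger_numerics {b₁ : ℝ} (hb : 1 / 8 ≤ b₁) (hU : Fcc.FccScaleNumerics) (hF : ChargeRecount)
    (hIP : ImprovablePricingG (3 / 20) (1 / 10) (6 / 5) 10 (1 / 100) (3 / 5))
    (hFCP : FrustratedCorePricingG (3 / 20) (1 / 10) (6 / 5) 10 (1 / 100) 40 (3 / 5))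
    (hCCP : CoherentCorePricingG (3 / 20) (1 / 10) (6 / 5) 10 (1 / 100) 40 (1 / 10) 40 (3 / 5))
    (hB : CoreBallRegularPricingW (maxCoverWeights (3 / 20) (1 / 10) (6 / 5) 10 (1 / 100) 40 (1 / 10) 40 160) (1 / 20) (3 / 5) 10
      fun _ _ => True)
    (hLab : CleanLabellingW (maxCoverWeights (3 / 20) (1 / 10) (6 / 5) 10 (1 / 100) 40 (1 / 10) 40 160) (3 / 5) 10 (1 / 3) 3)
    (hSB : ShellBudgetW (maxCoverWeights (3 / 20) (1 / 10) (6 / 5) 10 (1 / 100) 40 (1 / 10) 40 160) (3 / 5) 100000)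
    (hLf : LoadBoundQ IsFccImage (3 / 5) (1 / 3) 3 (1 / 100) (3 / 100) 160 (2 / 5) 3 b₁ 80 (6 / 5) (3 / 4) (3 / 10000000) (9 / 1000000))
    (hNf : NnStiffCls IsFccImage (27 / 10) (6 / 5))
    (hOL : OctLedgerQ (IsCubicFccImage (1921 / 2000) (977 / 1000)) (3 / 5) (1 / 3) 3 (1 / 100) (3 / 100) 160 (2 / 5) 3 b₁ 80 (6 / 5) (3 / 2)
      (1 / 2) (679 / 1000) (691 / 1000))
    (hΛ₁ : OctCertLedgerQ (IsCubicFccImage (Fcc.a0 * Real.sqrt 2) (Fcc.a0 * Real.sqrt 2)) (3 / 5) (1 / 3) 3 (3 / 100) 160 80 (6 / 5) (3 / 2)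
      (679 / 1000) (691 / 1000) (1 / 60000000) (1 / 2000000))
    (hFf : FarTrussQ IsFccImage (3 / 5) (1 / 3) 3 (1 / 100) (3 / 100) 160 (2 / 5) 3 b₁ 80 (6 / 5) (3 / 2) (11 / 20) (1 / 25) (1 / 60000000)
      (1 / 2000000))
    (hGf : GeoExchQ IsFccImage (3 / 5) (1 / 3) 3 (1 / 100) (3 / 100) 160 (2 / 5) 3 b₁ 80 (6 / 5) (3 / 20) (1 / 25) (1 / 30000000) (1 / 1000000))
    (hLh : LoadBoundQ IsHcpImage (3 / 5) (1 / 3) 3 (1 / 100) (3 / 100) 160 (2 / 5) 3 b₁ 80 (6 / 5) (3 / 4) (3 / 10000000) (9 / 1000000))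
    (hNh : NnStiffCls IsHcpImage (27 / 10) (6 / 5))
    (hMh : MidTrussQ IsHcpImage (3 / 5) (1 / 3) 3 (1 / 100) (3 / 100) 160 (2 / 5) 3 b₁ 80 (6 / 5) (3 / 2) (1 / 2) 0 (1 / 60000000) (1 / 2000000))
    (hFh : FarTrussQ IsHcpImage (3 / 5) (1 / 3) 3 (1 / 100) (3 / 100) 160 (2 / 5) 3 b₁ 80 (6 / 5) (3 / 2) (1 / 2) (1 / 40) (1 / 60000000)
      (1 / 2000000))
    (hGh : GeoExchQ IsHcpImage (3 / 5) (1 / 3) 3 (1 / 100) (3 / 100) 160 (2 / 5) 3 b₁ 80 (6 / 5) (1 / 5) (1 / 40) (1 / 30000000) (1 / 1000000))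
    (hN : LocalSeamReductionQ (3 / 5) (1 / 3) 3 (1 / 100) (3 / 100) (1 / 2) 160 (2 / 5) 3 b₁ 80 (1 / 3000000) (1 / 100000)
      (maxCoverWeights (3 / 20) (1 / 10) (6 / 5) 10 (1 / 100) 40 (1 / 10) 40 160) (1 / 20) 10 100000)
    (hP : ChartedChargePricingG (3 / 20) (1 / 10) (3 / 5)) : ChargedEnergyGap :=
  chargedEnergyGap_of_edgeSpaceDeficit_numerics hb hU hF hIP hFCP hCCP hB hLab hSB hLf hNf hOL
    (octDefLedgerQ_of_certLedger (by norm_num) (by norm_num) hΛ₁) hFf hGf hLh hNh hMh hFh hGh hN hP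

end CertLedger

end Summit.AtomisticToContinuum.Crystallization.Theorems.ChargedEnergyGapChartDial
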